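import Summits.AtomisticToContinuum.FouriersLaw.Theorems.BondHeatUncertaintySubdiffusiveBondHeatSqrtResponse
import Summits.AtomisticToContinuum.FouriersLaw.Theorems.JunctionLocalityNonBallisticOfConeScaleCorrector

/-!
# The half-Ohmic rung is FED: `ConeScaleCorrector → SqrtResponse` (hence `→ HalfOhmicFloor`)

Support file for stmt-AtomisticToContinuum-11071 (`BondHeatUncertainty.BoundedResponse`; residual of record 11071 ∧ 9121),
decomposition cell `decomp-a2c`, lens-1 (grading), gen 57 — file (7b); file (7a) is `…SubdiffusiveBondHeatSqrtResponse.lean`.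

Before this file the exponent ladder `ExponentFloor s`, `0 < s < 1`, had only arrows from ABOVE in the tree
(`exponentFloor_of_boundedResponse`), while every junction/defect node of the cell (`boundedResponse_of_splitLaw_of_exponentFloor`,
`boundedResponse_of_profileSplitLaw`, …) consumes SOME floor `F(s)`, `s > θ`.  Here is the first arrow INTO the ladder strictly
below the blocker, from an OPEN crux of a sibling route:

* `response_le_sqrt_of_coneScaleCorrector` — **E1 ⟹ `D ≤ S(T)·√N`** for every `N ≥ 2` and every response coefficient `D` of the
  `N`-chain at `T`, along every steady-state family under weak-NESS uniqueness: the cone-scale corrector bound `‖u_N‖²_{μ_T} ≤ C N² Z`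
  (crux E1 `OddSectorIrreversibility.ConeScaleCorrector`, stmt-AtomisticToContinuum-14069, OPEN) + the PROVED fixed-`N` corrector
  calculus (`Corrector.CorrectorTheory_proof`: Green–Kubo identity `Z(N-1)T²D = ⟨u_N, J_tot⟩_{μ_T}` with the landed pairing lemma
  `pinnedChain_integral_corrector_mul_withDensity`) + the landed `N`-uniform statics `‖J_tot‖²_{μ_T} ≤ C_J N Z`
  (`NonBallistic.exists_totalCurrent_sq_le`) + weighted AM–GM with the `N`-DEPENDENT weight `θ = 1/√N`
  (the tree's `NonBallistic.nonBallistic_of_coneScaleCorrector` takes a constant weight and extracts only `D_N = o(N)`).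
* `sqrtResponse_of_coneScaleCorrector` — **E1 ⟹ `R(1/2)`** (uniqueness is the tree theorem `bondHeatUncertainty_nessUnique_holds`);
  `halfOhmicFloor_of_coneScaleCorrector` — **E1 ⟹ `F(1/2)`** (`sqrtResponse_iff_halfOhmicFloor`, file 7a).
* corollaries: `boundedResponse_of_splitLaw_of_coneScaleCorrector` (`SplitLaw θ`, `θ < 1/2`, + E1 ⟹ 11071),
  `boundedResponse_of_coneScaleCorrector_of_bootstrap` (E1 + `ExponentBootstrap (1/2)` ⟹ 11071), and the NODE instances
  `boundedResponse_of_bufferedJunctionLaw_of_coneScaleCorrector` / `boundedResponse_of_localityPassivityLaw_of_coneScaleCorrector`: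
  **11071 ⟸ LocalityPassivityLaw ∧ ConeScaleCorrector** — both pieces typed (file (5) Props; item 14069), seam proved here.

So the cell's splits `11071 ⟸ (defect law, θ < 1/2) ∧ F(1/2)` now read `11071 ⟸ (defect law) ∧ ConeScaleCorrector`: two typed pieces,
each strictly below 11071 as far as the tree knows (E1 alone yields `D_N = O(√N)`, not `O(1)`).  Conditional only on the open item 14069;
nothing here closes an item; no `def`s.  References: Kundu–Dhar–Narayan 2009 (open-chain Green–Kubo); folklore.
-/

noncomputable section

open MeasureTheory Filter Topology Set
open scoped BigOperators ENNReal

namespace Summit.AtomisticToContinuum.FouriersLaw.Theorems.SubdiffusiveBondHeat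

namespace EscapeGrading

open Literature.MathematicalPhysics.KineticTheory.HeatConduction
open Summit.AtomisticToContinuum.FouriersLaw.Theses.BondHeatUncertainty (BoundedResponse)
open Summit.AtomisticToContinuum.FouriersLaw.Theses.OddSectorIrreversibility (ConeScaleCorrector)
open Summit.AtomisticToContinuum.FouriersLaw.Theorems.NonBallistic (mul_le_weighted_amgm exists_totalCurrent_sq_le)

/-- **E1 ⟹ `D ≤ S·√N`.**  Under weak-NESS uniqueness, along every steady-state family, for every `T > 0` there is
`S = S(ω₂, λ, β, γ, T) ≥ 0` with `D ≤ S√N` for every `N ≥ 2` and every response coefficient `D` of the `N`-chain at `T`: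
Green–Kubo in corrector form `Z(N-1)T²D = ⟨u, J_tot⟩_{μ_T}` (PROVED `CorrectorTheory`), AM–GM with weight `θ = 1/√N`,
E1 `‖u‖² ≤ C₁N²Z` and the statics `‖J_tot‖² ≤ C_J N Z` give `(N-1)T²D ≤ (C₁+C_J)N√N/2 ≤ (C₁+C_J)(N-1)√N`. [folklore] -/
theorem response_le_sqrt_of_coneScaleCorrector (hE1 : ConeScaleCorrector) {ω₂ lam β γ : ℝ}
    (hω : 0 < ω₂) (hl : 0 < lam) (hβ : 0 < β) (hγ : 0 < γ)
    (huniq : ∀ (N : ℕ) (T_L T_R : ℝ), 0 < T_L → 0 < T_R → ∀ μ ν : Measure (PhaseSpace N),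
      (pinnedChain ω₂ lam β γ).IsSteadyState N T_L T_R μ → (pinnedChain ω₂ lam β γ).IsSteadyState N T_L T_R ν →
        μ = ν)
    (μ : (N : ℕ) → ℝ → ℝ → Measure (PhaseSpace N))
    (hμ : ∀ (N : ℕ) (T_L T_R : ℝ), 0 < T_L → 0 < T_R →
      (pinnedChain ω₂ lam β γ).IsSteadyState N T_L T_R (μ N T_L T_R))
    {T : ℝ} (hT : 0 < T) :
    ∃ S : ℝ, 0 ≤ S ∧ ∀ (N : ℕ) (D : ℝ), 2 ≤ N →
      Tendsto (fun δ : ℝ => (pinnedChain ω₂ lam β γ).totalCurrent (μ N (T + δ / 2) (T - δ / 2)) / δ)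
        (𝓝[≠] 0) (𝓝 D) → D ≤ S * Real.sqrt N := by
  obtain ⟨C₁, hE1N⟩ := hE1 ω₂ lam β γ hω hl hβ hγ T hT
  obtain ⟨CJ, hCJ0, hJ⟩ := exists_totalCurrent_sq_le hω hl.le hβ.le γ hT
  have hCT :=
    Summit.AtomisticToContinuum.FouriersLaw.Theorems.OddSectorIrreversibility.Corrector.CorrectorTheory_proof
  have hT2 : 0 < T ^ 2 := by positivity
  set C₁' : ℝ := max C₁ 1 with hC₁'def
  have hC₁'1 : 1 ≤ C₁' := le_max_right _ _
  have hC₁'0 : 0 < C₁' := lt_of_lt_of_le one_pos hC₁'1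
  refine ⟨(C₁' + CJ) / T ^ 2, by positivity, fun N D hN2 hD => ?_⟩
  have hNpos : 0 < N := by omega
  set P := pinnedChain ω₂ lam β γ with hP
  set n : ℝ := (N : ℝ) with hndef
  have hn2 : (2 : ℝ) ≤ n := by rw [hndef]; exact_mod_cast hN2
  have hn1 : 0 < n - 1 := by linarith
  have hn0 : 0 < n := by linarith
  have hsq : 0 < Real.sqrt n := Real.sqrt_pos.2 hn0
  -- the `N`-dependent AM–GM weight `θ = 1/√n = √n/n`
  set θ : ℝ := 1 / Real.sqrt n with hθdef
  have hθ : 0 < θ := by positivity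
  have hθ' : θ = Real.sqrt n / n := (Real.sqrt_div_self').symm
  -- the corrector at `N` (CorrectorTheory A) and the Green–Kubo identity (CorrectorTheory B)
  obtain ⟨u, hu1, hu2, hu3, hu4, h5, h6, h7⟩ := hCT.1 ω₂ lam β γ hω hl hβ hγ T hT N
  obtain ⟨hcI, hGKB⟩ := hCT.2 ω₂ lam β γ hω hl hβ hγ huniq μ hμ T hT N D hD
  simp only [] at hu1 hu2 hu3 hu4 h5 h6 h7 hcI hGKB
  clear h5 h6 h7 hu1
  have hpair := Summit.AtomisticToContinuum.FouriersLaw.Theorems.pinnedChain_integral_corrector_mul_withDensity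
    hω hl.le hβ hγ hNpos hT hu2 hu4 hcI
  set μT : Measure (PhaseSpace N) := volume.withDensity fun x : PhaseSpace N =>
    ENNReal.ofReal (Real.exp (-(P.hamiltonian N x) / T)) with hμT
  set Z : ℝ := ∫ x : PhaseSpace N, Real.exp (-(P.hamiltonian N x) / T) with hZdef
  set J : PhaseSpace N → ℝ := fun x => ∑ i : Fin N, P.bondCurrent N i x with hJdef
  have hZ : 0 < Z := integral_exp_pos (pinnedChain_integrable_gibbsDensity hω hl.le hβ.le γ N hT)
  -- `⟨u, J⟩_{μ_T} = Z (N-1) T² D`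
  have hGK : ∫ x, u x * J x ∂μT = Z * ((n - 1) * T ^ 2 * D) := by
    rw [hGKB]; exact hpair.2
  -- E1 at this `N` and this `u`
  have hE1' : ∫ x, (u x) ^ 2 ∂μT ≤ C₁' * n ^ 2 * Z := by
    have h := hE1N N u
    simp only [] at h
    refine (h hu3).2.trans ?_
    exact mul_le_mul_of_nonneg_right (mul_le_mul_of_nonneg_right
      ((le_max_left _ _).trans (max_le_max le_rfl zero_le_one)) (sq_nonneg _)) hZ.le
  -- the static bound at this `N`
  have hJ' : ∫ x, (J x) ^ 2 ∂μT ≤ CJ * n * Z := hJ N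
  -- integrability of the three integrands
  have huJ : Integrable (fun x => u x * J x) μT := hpair.1
  have hu2i : Integrable (fun x => (u x) ^ 2) μT := hu2.integrable_sq
  have hJ2i : Integrable (fun x => (J x) ^ 2) μT := by
    have hsm := Summit.AtomisticToContinuum.FouriersLaw.Theorems.pinnedChain_withDensity_eq_smul_gibbsMeasure
      (γ := γ) (N := N) hω hl.le hT hβ.le
    have hZt : P.partitionFunction N T ≠ ⊤ :=
      P.partitionFunction_ne_top (pinnedChain_integrable_gibbsDensity hω hl.le hβ.le γ N hT)
    have hπ := (Summit.AtomisticToContinuum.FouriersLaw.Theorems.pinnedChain_sq_act_sum_bondCurrent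
      hω hl.le hβ hγ hNpos hT 0).1
    rw [hμT, hsm]
    exact hπ.smul_measure hZt
  -- AM–GM under the integral
  have hamgm : ∫ x, u x * J x ∂μT ≤ θ / 2 * ∫ x, (u x) ^ 2 ∂μT + 1 / (2 * θ) * ∫ x, (J x) ^ 2 ∂μT := by
    have hgi : Integrable (fun x => θ / 2 * (u x) ^ 2 + 1 / (2 * θ) * (J x) ^ 2) μT :=
      (hu2i.const_mul (θ / 2)).add (hJ2i.const_mul (1 / (2 * θ)))
    have hmono : ∫ x, u x * J x ∂μT ≤ ∫ x, (θ / 2 * (u x) ^ 2 + 1 / (2 * θ) * (J x) ^ 2) ∂μT :=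
      integral_mono huJ hgi fun x => mul_le_weighted_amgm hθ (u x) (J x)
    have hsum : ∫ x, (θ / 2 * (u x) ^ 2 + 1 / (2 * θ) * (J x) ^ 2) ∂μT =
        θ / 2 * ∫ x, (u x) ^ 2 ∂μT + 1 / (2 * θ) * ∫ x, (J x) ^ 2 ∂μT := by
      rw [integral_add (hu2i.const_mul _) (hJ2i.const_mul _), integral_const_mul, integral_const_mul]
    exact hmono.trans_eq hsum
  -- combine and divide by `Z`
  have hmain : (n - 1) * T ^ 2 * D ≤ θ / 2 * (C₁' * n ^ 2) + 1 / (2 * θ) * (CJ * n) := by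
    have h1 : Z * ((n - 1) * T ^ 2 * D) ≤ Z * (θ / 2 * (C₁' * n ^ 2) + 1 / (2 * θ) * (CJ * n)) := by
      calc Z * ((n - 1) * T ^ 2 * D) = ∫ x, u x * J x ∂μT := hGK.symm
        _ ≤ θ / 2 * ∫ x, (u x) ^ 2 ∂μT + 1 / (2 * θ) * ∫ x, (J x) ^ 2 ∂μT := hamgm
        _ ≤ θ / 2 * (C₁' * n ^ 2 * Z) + 1 / (2 * θ) * (CJ * n * Z) := by
            gcongr
        _ = Z * (θ / 2 * (C₁' * n ^ 2) + 1 / (2 * θ) * (CJ * n)) := by ring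
    exact le_of_mul_le_mul_left h1 hZ
  -- arithmetic with `θ = 1/√n`: both terms are multiples of `n√n`
  have hs0 : Real.sqrt n ≠ 0 := hsq.ne'
  have hn0' : n ≠ 0 := hn0.ne'
  have hterm1 : θ / 2 * (C₁' * n ^ 2) = C₁' * Real.sqrt n * n / 2 := by
    rw [hθ']
    field_simp
  have hterm2 : 1 / (2 * θ) * (CJ * n) = CJ * Real.sqrt n * n / 2 := by
    rw [hθdef]
    field_simp
  have hfin : (n - 1) * T ^ 2 * D ≤ (n - 1) * T ^ 2 * ((C₁' + CJ) / T ^ 2 * Real.sqrt n) := by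
    have hK : 0 ≤ (C₁' + CJ) * Real.sqrt n := by positivity
    calc (n - 1) * T ^ 2 * D ≤ θ / 2 * (C₁' * n ^ 2) + 1 / (2 * θ) * (CJ * n) := hmain
      _ = (C₁' + CJ) * Real.sqrt n * n / 2 := by rw [hterm1, hterm2]; ring
      _ ≤ (C₁' + CJ) * Real.sqrt n * (n - 1) := by nlinarith [hK, hn2]
      _ = (n - 1) * T ^ 2 * ((C₁' + CJ) / T ^ 2 * Real.sqrt n) := by
          field_simp
  have hpos : 0 < (n - 1) * T ^ 2 := by positivity
  exact le_of_mul_le_mul_left hfin hpos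

/-- **`ConeScaleCorrector → SqrtResponse`: the rung `R(1/2)` is FED by crux E1 (stmt-14069).**  Weak-NESS uniqueness is the tree theorem
`bondHeatUncertainty_nessUnique_holds`; the constant `S(T)` of `response_le_sqrt_of_coneScaleCorrector` serves every `N ≥ 2`. [folklore] -/
theorem sqrtResponse_of_coneScaleCorrector (hE1 : ConeScaleCorrector) : SqrtResponse := by
  intro ω₂ lam β γ hω hl hβ hγ μ hμ T hT D hD
  have huniq := bondHeatUncertainty_nessUnique_holds ω₂ lam β γ hω hl hβ hγ
  obtain ⟨S, -, hS⟩ := response_le_sqrt_of_coneScaleCorrector hE1 hω hl hβ hγ huniq μ hμ hT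
  exact ⟨S, fun N hN => hS N (D N) hN (hD N)⟩

/-- **`ConeScaleCorrector → HalfOhmicFloor`** (`F(1/2)` is fed; `sqrtResponse_iff_halfOhmicFloor`). [folklore] -/
theorem halfOhmicFloor_of_coneScaleCorrector (hE1 : ConeScaleCorrector) : HalfOhmicFloor :=
  halfOhmicFloor_of_sqrtResponse (sqrtResponse_of_coneScaleCorrector hE1)

/-- E1 feeds every rung `F(a)`, `a ≤ 1/2`. [folklore] -/
theorem exponentFloor_of_coneScaleCorrector {a : ℝ} (ha : a ≤ 1 / 2) (hE1 : ConeScaleCorrector) : ExponentFloor a :=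
  exponentFloor_anti ha (halfOhmicFloor_of_coneScaleCorrector hE1)

/-- **Defect law + E1 ⟹ 11071**: `SplitLaw θ` with `θ < 1/2` (in particular the constant-defect law `SplitLaw 0` of the buffered-junction /
locality–passivity node) and `ConeScaleCorrector` give `BoundedResponse`. [kernel · frame] -/
theorem boundedResponse_of_splitLaw_of_coneScaleCorrector {θ : ℝ} (hθ : θ < 1 / 2)
    (hS : JunctionDefectGrading.SplitLaw θ) (hE1 : ConeScaleCorrector) : BoundedResponse :=
  boundedResponse_of_splitLaw_of_sqrtResponse hθ hS (sqrtResponse_of_coneScaleCorrector hE1)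

/-- **E1 + the half-bootstrap ⟹ 11071**: `ConeScaleCorrector → ExponentBootstrap (1/2) → BoundedResponse`. [kernel · frame] -/
theorem boundedResponse_of_coneScaleCorrector_of_bootstrap (hE1 : ConeScaleCorrector)
    (hB : ExponentBootstrap (1 / 2 : ℝ)) : BoundedResponse :=
  boundedResponse_of_sqrtResponse_of_bootstrap (sqrtResponse_of_coneScaleCorrector hE1) hB

/-- **Buffered junction law + E1 ⟹ 11071.** [kernel · frame] -/
theorem boundedResponse_of_bufferedJunctionLaw_of_coneScaleCorrector (hB : JunctionDefectGrading.BufferedJunctionLaw)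
    (hE1 : ConeScaleCorrector) : BoundedResponse :=
  boundedResponse_of_bufferedJunctionLaw_of_sqrtResponse hB (sqrtResponse_of_coneScaleCorrector hE1)

/-- **NODE: `LocalityPassivityLaw ∧ ConeScaleCorrector ⟹ 11071`** — junction locality + buffer passivity (file (5)) and the cone-scale
corrector bound E1 (stmt-14069): the residual of record 11071 beneath two typed pieces, neither of which is 11071 as far as the tree knows.
[kernel · frame] -/
theorem boundedResponse_of_localityPassivityLaw_of_coneScaleCorrector (hL : JunctionDefectGrading.LocalityPassivityLaw)
    (hE1 : ConeScaleCorrector) : BoundedResponse :=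
  boundedResponse_of_localityPassivityLaw_of_sqrtResponse hL (sqrtResponse_of_coneScaleCorrector hE1)

end EscapeGrading

end Summit.AtomisticToContinuum.FouriersLaw.Theorems.SubdiffusiveBondHeat

end
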